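import Mathlib
import HarnessLib
import Summits.CriticalPhenomena.SAWScalingLimit.Theses.SAWRenewalTightness
import Literature.Probability.RandomPlanarGeometry.CrossingCondition
import Literature.Probability.RandomPlanarGeometry.SAWBridges

/-!
# Sketch — crux-ideate stmt-CriticalPhenomena-4728 (ShellCrossingBound), ideator 3, round 1

First lemmas of the two idea cards, typed over existing declarations (no proofs claimed):

* card `flat-shell-arches-gamma11`: `IsArch`, `ArchSusceptibilityFinite` (χ₁₁(x_c) < ∞ on ℤ²,
  the new scale-free input), `DeepArchTail` (the form the surgery consumes), and the
  provable-now side lemma `EventualStrictBridgeMass` (Kesten + Erdős–Feller–Pollard).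
* card `door-peeling-g2alpha`: `G2AlphaEventual` (KS Condition G2 for the critical ℤ² SAW with
  ANY constant α < 1, eventual in the mesh, scales ≥ mesh) and the transfer `G2AlphaTransfer`
  (KS 2017 Lemma 3.6 + repeated conditioning; the free threshold k absorbs n₀).
-/

open scoped BigOperators Classical ENNReal
open MeasureTheory Filter Set

namespace Summit.CriticalPhenomena.SAWScalingLimit.Cruxes.ShellCrossingBound.Ideator3

open Literature.Probability.RandomPlanarGeometry Literature.Probability.LatticeModels

/-- An **arch** (surface loop): an `n`-step self-avoiding walk from `0` (vertex function, as in
`SAW.Zd.saws`) whose interior lies strictly in the half-space `{x₀ > 0}` and whose endpoint is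
back on the line `{x₀ = 0}` (`n ≥ 2`). The objects counted by the surface–surface
susceptibility χ₁₁. -/
def IsArch (n : ℕ) (ω : ℕ → Site 2) : Prop :=
  2 ≤ n ∧ (∀ i, 1 ≤ i → i < n → 0 < ω i 0) ∧ ω n 0 = 0

/-- **χ₁₁(x_c) < ∞ on ℤ²** (card 1, the new input): the x_c-mass of all arches from the origin
is finite (all partial sums bounded). Predicted by γ₁₁ = −3/16 < 0; proved on the hexagonal
lattice by the Duminil-Copin–Smirnov strip identity (A_T ≤ 1/c_α); open on ℤ². -/
def ArchSusceptibilityFinite : Prop :=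
  ∃ C : ℝ, ∀ N : ℕ,
    (∑ n ∈ Finset.range (N + 1),
      ∑ _ω ∈ (SAW.Zd.saws 2 n).filter (fun ω => IsArch n ω), SAW.criticalFugacity ^ n) ≤ C

/-- **Deep-arch tail** (card 1, consumed form): the x_c-mass of arches from the origin reaching
depth `≥ H` tends to `0` as `H → ∞` (follows from `ArchSusceptibilityFinite` by monotone
convergence; at mesh δ an extra in–out traversal pair of a flat shell of width `R − ρ` through
one side is an arch of depth `≥ (R − ρ)/δ → ∞`). -/
def DeepArchTail : Prop :=
  ∀ ε : ℝ, 0 < ε → ∃ H : ℤ, ∀ N : ℕ,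
    (∑ n ∈ Finset.range (N + 1),
      ∑ _ω ∈ (SAW.Zd.saws 2 n).filter (fun ω => IsArch n ω ∧ ∃ i, i ≤ n ∧ H ≤ ω i 0),
        SAW.criticalFugacity ^ n) ≤ ε

/-- **Eventual strict bridge mass** (card 1, provable now): Kesten's renewal structure
(`KestenIdentity`, `StripMassConservation` of the route: u_L = span-L bridge mass is the renewal
sequence of the law p_ℓ = x_c-mass of irreducible bridges of span ℓ, Σ p_ℓ = 1, p₁ > 0) plus the
Erdős–Feller–Pollard renewal theorem give u_L → 1/m, m = Σ ℓ p_ℓ ≥ 2 − p₁ > 1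
(p₁ = x_c(1+x_c)/(1−x_c) < 1 because x_c < √2 − 1), hence u_L ≤ q < 1 for all large L. -/
def EventualStrictBridgeMass : Prop :=
  ∃ q : ℝ, q < 1 ∧ ∃ L₀ : ℤ, ∀ L : ℤ, L₀ ≤ L → ∀ N : ℕ,
    (∑ n ∈ Finset.range (N + 1),
      ∑ _ω ∈ (SAW.Zd.bridges 2 n).filter (fun ω => ω n 0 = L), SAW.criticalFugacity ^ n) ≤ q

/-- **G2 with any constant, eventual** (card 2, the crux⁺): Kemppainen–Smirnov's Condition G2 for
the critical ℤ² SAW chord laws with SOME constant α < 1 (not 1/2), for meshes δ ≤ δ₀(D,a,b) and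
annuli at scales ≥ δ — the integrated conditional form of `ConditionG2` (CrossingCondition.lean)
at the marked law `(D.carrier, δ·a_δ, δ·b_δ, law ↦ curve)`. -/
def G2AlphaEventual : Prop :=
  ∃ α : ℝ, α < 1 ∧ ∃ C : ℝ, 1 < C ∧
    ∀ (D : DobrushinDomain) (a b : ℝ → Site 2), SAW.IsEndpointApprox D a b →
      ∃ δ₀ : ℝ, 0 < δ₀ ∧ ∀ δ ∈ Set.Ioc (0 : ℝ) δ₀, ∀ F : Set ℂ, IsClosed F → F.Nonempty →
        ∀ (z₀ : ℂ) (r R : ℝ), δ ≤ r → C * r ≤ R →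
          ∀ S : Set (CurveClass ℂ), MeasurableSet S →
            ((SAW.law D.carrier δ (a δ) (b δ)).map (fun γ => γ.curve))
                (CurveClass.stopAt F ⁻¹' S ∩
                  unforcedCrossingEvent D.carrier (meshPoint δ (b δ)) F z₀ r R) ≤
              ENNReal.ofReal α *
                ((SAW.law D.carrier δ (a δ) (b δ)).map (fun γ => γ.curve))
                  (CurveClass.stopAt F ⁻¹' S)

/-- **Transfer** (card 2): `G2AlphaEventual → ShellCrossingBound` — Kemppainen–Smirnov 2017,
Lemma 3.6 (n crossings of A ⇒ ≥ (n − n₀)/2 unforced crossings of the three sub-annuli) and the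
proof of their Proposition "G2 ⇒ AB (H1)", run with the constant α at ONE aspect ratio C
(sub-annuli of A have aspect (R/ρ)^{1/3} ≥ C once R/ρ ≥ C³; smaller aspect ratios are absorbed in
K) and with the shell-dependent threshold k(x,ρ,R) := n₀(x,ρ,R) + 2⌈λ log(R/ρ)/log(1/α)⌉. -/
def G2AlphaTransfer : Prop :=
  G2AlphaEventual →
    Summit.CriticalPhenomena.SAWScalingLimit.Theses.SAWRenewalTightness.ShellCrossingBound

end Summit.CriticalPhenomena.SAWScalingLimit.Cruxes.ShellCrossingBound.Ideator3
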